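import Mathlib.Probability.Distributions.SetBernoulli
import Mathlib.Computability.Language
import HarnessLib

/-!
# The random oracle: the law of a uniformly random language `A ⊆ {0,1}*`

The law of a uniformly random language `A ⊆ {0,1}*` — each string belongs to `A` independently
with probability `1/2` — as a measure `randomOracle` on the carrier `Set (List Bool)` (samples
are read as `Language Bool` by definitional unfolding; there is no
`MeasurableSpace (Language Bool)` instance and none is added). It is Mathlib's product Bernoulli
measure on sets `ProbabilityTheory.setBernoulli` (`Mathlib/Probability/Distributions/SetBernoulli.lean`,
notation `setBer(u, p)`, API `setBernoulli_apply`, `setBernoulli_ae_subset`, …) at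
`u = Set.univ`, `p = 1/2`, with its `IsProbabilityMeasure` instance (Mathlib's, recovered by
unfolding).

## Why this module exists (fact-free home)

This file imports Mathlib and `HarnessLib` only: it declares no named fact and no conjecture, so
a route thesis or a Literature file that merely needs "with probability `1` over the random
oracle `A`" imports it without taking any unproved fact into its module cone.

The tree's older spelling `Literature.Computability.QuantumComplexity.randomOracleMeasure`
(`OracleSeparations.lean`, the home of the oracle-separation facts `exists_oracle_BQPRel_*` and
`yamakawa_zhandry`) denotes the same measure; that file imports this one and keeps
`randomOracleMeasure` as a reducible synonym (`abbrev randomOracleMeasure := randomOracle`), so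
every statement written with either name is definitionally the statement written with the
other (reducibly: `with_reducible rfl`), and the toolkit proved over `randomOracleMeasure`
(`RandomOracleCylinders.lean`: `restrictBool`, `randomOracleMeasure_restrictBool`,
`oracleCylinder`, conditional densities; `RandomOracleIndependence.lean`) applies verbatim. The
name could not simply be moved here: the gate pins a fully-qualified name to the module that
first declared it (one name, one module), and `randomOracleMeasure` has importers.

## Sources

* C. H. Bennett, J. Gill, *Relative to a random oracle `A`, `P^A ≠ NP^A ≠ co-NP^A` with
  probability 1*, SIAM J. Comput. 10 (1981), §1 — the random-oracle measure: one fair independent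
  coin per string [BennettGill1981].
* T. Yamakawa, M. Zhandry, *Verifiable quantum advantage without structure* (FOCS 2022;
  arXiv:2204.02063), §2 — the random oracle model [YamakawaZhandry2022].

## Design choice

A `def` equal to `setBer(Set.univ, 1/2)` (rather than an `infinitePi` of fair coins on
`List Bool → Bool`; the two agree along `O ↦ {x | O x}`), so that Mathlib's `setBernoulli` API
applies after `unfold randomOracle`.
-/

open MeasureTheory ProbabilityTheory

namespace Literature.Computability.QuantumComplexity

/-- The **random oracle** (as a probability law): the law of a uniformly random language
`A ⊆ {0,1}*`, each string belonging to `A` independently with probability `1/2`; this is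
Mathlib's product Bernoulli measure on sets `setBer(Set.univ, 1/2)` on the carrier
`Set (List Bool)` (samples are used as `Language Bool` by definitional unfolding), so that
"`P(A)` holds with probability `1` over the random oracle" is `∀ᵐ A ∂randomOracle, P A`. The
synonym `randomOracleMeasure` of `OracleSeparations.lean` unfolds reducibly to this definition.
[Bennett–Gill, SIAM J. Comput. 10 (1981), §1 (random oracles); Yamakawa–Zhandry 2022, §2 (random
oracle model)] [cite: BennettGill1981, §1 (the random-oracle measure)] -/
noncomputable def randomOracle : Measure (Set (List Bool)) :=
  setBer((Set.univ : Set (List Bool)), ⟨1 / 2, by norm_num, by norm_num⟩)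

/-- The random oracle is a probability measure (Mathlib's instance for `setBernoulli`,
recovered by unfolding). [Bennett–Gill 1981, §1] [cite: BennettGill1981, §1] -/
instance isProbabilityMeasure_randomOracle : IsProbabilityMeasure randomOracle := by
  unfold randomOracle; infer_instance

/-- `randomOracle` is `setBer(Set.univ, 1/2)` (definitional unfolding, for rewriting into
Mathlib's `setBernoulli` API). [folklore] -/
theorem randomOracle_eq_setBernoulli :
    randomOracle = setBer((Set.univ : Set (List Bool)), ⟨1 / 2, by norm_num, by norm_num⟩) :=
  rfl

end Literature.Computability.QuantumComplexity
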